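import Mathlib

/-!
# EriceRemainderEnclosureHistoryAutonomyComparisonAgeCompositionStaticChainCertificate — (E78a) THE SUBSOLUTION CERTIFICATE: static closure at a
# young step of the level-coupled system is the INFEASIBILITY of one explicit load vector, certified by one explicit non-negative subsolution —
# closure ⟸ `M_z ≤ 2(s_z + Ψ_zz)` (exact: `Ψ_zz` the return amplification of the young's reads through the older system) ⟸ `M_z ≤ 2s_z·A_z`
# (`A_z` the unloaded level at the young scale); and the chain side of the OBSERVER INDUCTION that is to prove it (`N_z ≤ (1+2κΨ_zz)(1−Ω_z)`)

Cell `pub-balaban`, β-function sub-cell, BINDER row D4 «RemainderConst leaves for Bałaban's split» (`HOME/BINDER-OWNERS.md`; owner lineage `b2b-balaban-beta-an4`;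
this file by co-owner #2 lineage `b2b-balaban-beta-d4-p2`, generation 69), β-FLOW TEAM duty (1), FREEZE (0) honoured (def-free, Mathlib only; (E72a), (E74a),
(E76b), (E77a)–(E77d) are referred to BY NAME, nothing restated).

HONEST FRAMING (page 1, verbatim and binding).  *"Discharging BetaPertH makes Bałaban's UV stability UNCONDITIONAL — a real constructive-QFT result; it is
NOT the continuum limit and NOT the Clay problem."*  THIS FILE DISCHARGES NOTHING OF THE KIND.  Elementary linear algebra of finite non-negative arrays and finite
sums of real numbers — hypotheses of a census, not facts; the form, signs, ages and moments of Bałaban's (1.22) limit functional are NOT PRINTED ([I] p. 298;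
GAPS G-t4-U2-1∕-2) and NOT asserted.  Row D4 class UNCHANGED (critical-path width 0; instance 0∕1; D4 DISCHARGE NO DATE).  HONEST DEPENDENCY: continuum YM on
T⁴ ⇐ BetaPertH ∧ nine spine estimates (0/9 proved); BetaPertH ⇐ (D1) ∧ (D4) ∧ CAP+tail; G-an2-4 gates asym, D1 and NE2/3/4.

THE POINT (census sense (α); route (N′) of READMEs `g67/e76`, `g68/e77`; this station `HOME/b2b-balaban-beta-d4-p2/g69/e78/README.md`).  The window-mass
static chain over the LEVEL-COUPLED system (loads `x_k ≥ 0` at integer ages, feasible iff positive levels `a_i ≥ 1 + Σ_l 2x_l (S(k_l,k_i)∕k_l) a_l`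
exist, (E76b)) must CLOSE: at every young scale `z`, `ρ_z = x_z·M_z < 1` with `M_z = (1+V_z)∕(1−Ω_z)` the chain's multiplier from the older ages
((E72a), (E74a)).  Generation 68 attacked this per older age («per-age domination», margins ≈ 10 %).  THIS FILE replaces the per-age architecture by
DUALITY: `x_z M_z < 1` for every admissible `x_z` says that the load vector `(x_old, 1∕M_z)` is INFEASIBLE, and infeasibility of a non-negative
system is CERTIFIED by a non-negative subsolution `v ≠ 0`, `G v ≥ v` (§1 `eq_zero_of_subsolution` — the Collatz–Wielandt bound against positive
levels, three lines, no spectral theory).  Two explicit certificates (§2): `v = (c, M∕2)` with `c` the older system's exact response to the young's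
reads gives closure ⟸ **`M_z ≤ 2(s_z + Ψ_zz)`**, `Ψ_zz = Σ_l 2x_lσ_l(z)c_l` (this is `M_z·x̂_z ≤ 1` with the EXACT cap `x̂_z = 1∕(2(s_z+Ψ_zz))`, the
Schur pivot of the young's row); `v = (a_old, t)` with the older system's exact levels gives closure ⟸ **`M_z ≤ 2s_z·A_z`**, `A_z = 1 + Σ_l
2x_lσ_l(z)a_l` the level an unloaded scale `z` would have.  NUMERICS OF RECORD (kit j318342∕j318343∕j318346 = `g69/numerics/jobA`, 36 families, young
at several positions, adversarial ascents + structured starts; README §3): **`sup M_z∕(2s_zA_z) = 0.7280`** (at `z = 1` with one light adjacent elder;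
`0.672` at `z = 2`, `0.652` (3), `0.642` (4), `≤ 0.63` for `z ≥ 6` — always `≈ 1.03 ×` the lone cap), against the threshold `1`: a UNIFORM 27 % margin where the
per-age architecture had 10 %; and `sup M_z x̂_z = lone cap × (1.000–1.007)` (g67∕g68's number, recomputed through the resolvent).
§3 is the chain side of the induction that is to PROVE the certificate inequality (README §4): carry for every scale `z` below the processed ages the
OBSERVER BOUND `N_z := 1 + V_z ≤ (1 + 2κΨ_zz)(1 − Ω_z)` (equality for no older age; numerically `sup (M_z−1)∕(2Ψ_zz) = 0.651`, attained at an
infinitesimal adjacent elder); it implies the certificate inequality (`multiplier_le_of_observer_bound`, `κ ≤ 1`, `2s_z ≥ 1`), bounds the next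
age's ratio by `ρ̄_y = x_y(1+2κΨ_yy) < 1` (`ratio_le_ratio_bar`, `ratio_bar_le_one_sub_pivot`: THE CHAIN COMPOUNDS NO FASTER THAN THE RESOLVENT), and
propagates to the enlarged system (`succ_numerator_le`, **`observer_step`**) as soon as ONE inequality (◆) between resolvent quantities of the
level-coupled system holds — no chain quantity left in it (README §4–§5; kit j318356∕7∕8 = `jobB`, 978 adversarial tasks: `sup LHS∕RHS = 0.914` at
`κ = 0.775`, binding configuration = one elder loaded at `0.33` just above an adjacent pair, continuum limit).
NOT CLAIMED: (◆) as a theorem (it is the successor's target; README §6); the static closure; anything about the flow (the instantiation `a = 1∕h²`,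
`X_k = L_k k h_k³` is (E76b)∕(E77d)'s); MONO; anything nonlinear; anything printed.

WHAT IS PROVED ([folklore]; 0 `def`, 0 sorry).  §1 **`eq_zero_of_subsolution`**, **`nonneg_of_response`**, `response_mono`, `response_unique`,
`response_ge_mul_level`.  §2 `sum_range_succ_ite`, **`load_lt_of_subsolution`**, **`load_mul_lt_one_of_certificate`**, **`load_mul_lt_one_of_level_certificate`**.
§3 `multiplier_le_of_observer_bound`, `ratio_le_ratio_bar`, `ratio_bar_le_one_sub_pivot`, `succ_numerator_le`, **`observer_step`**.
-/
noncomputable section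
open Finset

namespace Summit.QuantumFields.BalabanUV.Beta.EriceRemainderEnclosureHistoryAutonomyComparisonAgeCompositionStaticChainCertificate

/-! ## §1 The max-ratio lemma: positive levels exclude non-trivial subsolutions -/

variable {m : ℕ} {G : ℕ → ℕ → ℝ} {a v w u u' c φ : ℕ → ℝ}

/-- **POSITIVE LEVELS EXCLUDE SUBSOLUTIONS.**  `G ≥ 0` an `m × m` array, `a > 0` LEVELS of the system: `1 + Σ_l G_{il} a_l ≤ a_i` for every row
`i < m`; then any `v ≥ 0` with `v_i ≤ Σ_l G_{il} v_l` for every row vanishes identically.  (Take the row `i₀` maximising `v_i∕a_i =: τ`; then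
`v ≤ τ·a`, so `v_{i₀} ≤ τ·Σ_l G_{i₀l}a_l ≤ τ(a_{i₀} − 1) = v_{i₀} − τ`, whence `τ ≤ 0`.)  This is the Collatz–Wielandt lower bound `ρ(G) ≥ 1` for
a non-trivial subsolution against `ρ(G) < 1` for positive levels, proved without spectral theory. [folklore] -/
theorem eq_zero_of_subsolution (hG : ∀ i l, i < m → l < m → 0 ≤ G i l) (ha : ∀ i, i < m → 0 < a i)
    (hlev : ∀ i, i < m → 1 + ∑ l ∈ range m, G i l * a l ≤ a i) (hv : ∀ i, i < m → 0 ≤ v i)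
    (hsub : ∀ i, i < m → v i ≤ ∑ l ∈ range m, G i l * v l) : ∀ i, i < m → v i = 0 := by
  rcases Nat.eq_zero_or_pos m with hm | hm
  · intro i hi; omega
  obtain ⟨i₀, hi₀, hmax⟩ :=
    exists_max_image (range m) (fun i => v i / a i) ⟨0, mem_range.mpr hm⟩
  have hi₀' : i₀ < m := mem_range.mp hi₀
  set τ := v i₀ / a i₀ with hτ
  have hτ0 : 0 ≤ τ := div_nonneg (hv i₀ hi₀') (ha i₀ hi₀').le
  have hvle : ∀ l, l < m → v l ≤ τ * a l := by
    intro l hl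
    have h1 : v l / a l ≤ τ := hmax l (mem_range.mpr hl)
    rwa [div_le_iff₀ (ha l hl)] at h1
  have key : v i₀ ≤ τ * (a i₀ - 1) := by
    calc v i₀ ≤ ∑ l ∈ range m, G i₀ l * v l := hsub i₀ hi₀'
      _ ≤ ∑ l ∈ range m, G i₀ l * (τ * a l) :=
          sum_le_sum fun l hl => mul_le_mul_of_nonneg_left (hvle l (mem_range.mp hl)) (hG i₀ l hi₀' (mem_range.mp hl))
      _ = τ * ∑ l ∈ range m, G i₀ l * a l := by rw [mul_sum]; exact sum_congr rfl fun l _ => by ring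
      _ ≤ τ * (a i₀ - 1) := mul_le_mul_of_nonneg_left (by linarith [hlev i₀ hi₀']) hτ0
  have hvi : v i₀ = τ * a i₀ := by rw [hτ, div_mul_cancel₀ _ (ha i₀ hi₀').ne']
  have ha0 := ha i₀ hi₀'
  have hτle : τ ≤ 0 := by nlinarith
  have hτz : τ = 0 := le_antisymm hτle hτ0
  intro i hi
  have h1 := hvle i hi
  rw [hτz, zero_mul] at h1
  exact le_antisymm h1 (hv i hi)

/-- **EXACT RESPONSES TO NON-NEGATIVE SOURCES ARE NON-NEGATIVE.**  With positive levels as in `eq_zero_of_subsolution`, a vector `u` solving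
`u_i = w_i + Σ_l G_{il} u_l` exactly with a source `w ≥ 0` is `≥ 0` (its negative part is a non-negative subsolution).  This is the entrywise
positivity of the resolvent `(I − G)⁻¹` in the form the census uses. [folklore] -/
theorem nonneg_of_response (hG : ∀ i l, i < m → l < m → 0 ≤ G i l) (ha : ∀ i, i < m → 0 < a i)
    (hlev : ∀ i, i < m → 1 + ∑ l ∈ range m, G i l * a l ≤ a i) (hw : ∀ i, i < m → 0 ≤ w i)
    (hu : ∀ i, i < m → u i = w i + ∑ l ∈ range m, G i l * u l) : ∀ i, i < m → 0 ≤ u i := by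
  have h := eq_zero_of_subsolution (v := fun i => max 0 (-u i)) hG ha hlev (fun i _ => le_max_left _ _) ?_
  · intro i hi
    have h1 : max 0 (-u i) = 0 := h i hi
    have h2 : -u i ≤ 0 := by rw [← h1]; exact le_max_right _ _
    linarith
  · intro i hi
    have hsum0 : 0 ≤ ∑ l ∈ range m, G i l * max 0 (-u l) :=
      sum_nonneg fun l hl => mul_nonneg (hG i l hi (mem_range.mp hl)) (le_max_left _ _)
    rcases le_or_gt 0 (u i) with h0 | h0
    · rw [max_eq_left (by linarith)]; exact hsum0
    · rw [max_eq_right (by linarith)]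
      have hneg : ∑ l ∈ range m, G i l * (-u l) = -∑ l ∈ range m, G i l * u l := by
        rw [← sum_neg_distrib]; exact sum_congr rfl fun _ _ => by ring
      calc -u i = -w i + ∑ l ∈ range m, G i l * (-u l) := by rw [hneg, hu i hi]; ring
        _ ≤ ∑ l ∈ range m, G i l * (-u l) := by linarith [hw i hi]
        _ ≤ ∑ l ∈ range m, G i l * max 0 (-u l) :=
            sum_le_sum fun l hl => mul_le_mul_of_nonneg_left (le_max_right _ _) (hG i l hi (mem_range.mp hl))

/-- **COMPARISON OF RESPONSES.**  Exact responses are monotone in the source: if `u_i = w_i + Σ_l G_{il}u_l` and `u'_i = w'_i + Σ_l G_{il}u'_l`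
with `w ≤ w'`, then `u ≤ u'` (positive levels assumed). [folklore] -/
theorem response_mono {w' : ℕ → ℝ} (hG : ∀ i l, i < m → l < m → 0 ≤ G i l) (ha : ∀ i, i < m → 0 < a i)
    (hlev : ∀ i, i < m → 1 + ∑ l ∈ range m, G i l * a l ≤ a i) (hww : ∀ i, i < m → w i ≤ w' i)
    (hu : ∀ i, i < m → u i = w i + ∑ l ∈ range m, G i l * u l)
    (hu' : ∀ i, i < m → u' i = w' i + ∑ l ∈ range m, G i l * u' l) : ∀ i, i < m → u i ≤ u' i := by
  have h := nonneg_of_response (u := fun i => u' i - u i) (w := fun i => w' i - w i) hG ha hlev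
    (fun i hi => by linarith [hww i hi]) ?_
  · intro i hi; linarith [h i hi]
  · intro i hi
    have hsplit : ∑ l ∈ range m, G i l * (u' l - u l) = ∑ l ∈ range m, G i l * u' l - ∑ l ∈ range m, G i l * u l := by
      rw [← sum_sub_distrib]; exact sum_congr rfl fun _ _ => by ring
    simp only [hsplit]; linarith [hu i hi, hu' i hi]

/-- **UNIQUENESS OF EXACT RESPONSES.**  Two exact responses to the same source coincide (positive levels assumed) — so the scalars the
census builds from responses (`Ψ`, `A`) are well defined. [folklore] -/
theorem response_unique (hG : ∀ i l, i < m → l < m → 0 ≤ G i l) (ha : ∀ i, i < m → 0 < a i)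
    (hlev : ∀ i, i < m → 1 + ∑ l ∈ range m, G i l * a l ≤ a i)
    (hu : ∀ i, i < m → u i = w i + ∑ l ∈ range m, G i l * u l)
    (hu' : ∀ i, i < m → u' i = w i + ∑ l ∈ range m, G i l * u' l) : ∀ i, i < m → u i = u' i := fun i hi =>
  le_antisymm (response_mono hG ha hlev (fun _ _ => le_rfl) hu hu' i hi) (response_mono hG ha hlev (fun _ _ => le_rfl) hu' hu i hi)

/-- **RESPONSES DOMINATE LEVELS.**  If the source is bounded below by a constant, `w_i ≥ s`, and `a` are EXACT levels (`a_i = 1 + Σ_l G_{il}a_l`,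
`a > 0`), then the exact response satisfies `u_i ≥ s·a_i`.  (Used with `w = φ^z ≥ s_z·1`: the return amplification dominates `s_z` times the
unloaded level, `Ψ_zz ≥ s_z(A_z − 1)`.) [folklore] -/
theorem response_ge_mul_level {s : ℝ} (hG : ∀ i l, i < m → l < m → 0 ≤ G i l) (ha : ∀ i, i < m → 0 < a i)
    (hlev : ∀ i, i < m → a i = 1 + ∑ l ∈ range m, G i l * a l) (hws : ∀ i, i < m → s ≤ w i)
    (hu : ∀ i, i < m → u i = w i + ∑ l ∈ range m, G i l * u l) : ∀ i, i < m → s * a i ≤ u i := by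
  have h := response_mono (u := fun i => s * a i) (w := fun _ => s) (u' := u) (w' := w) hG ha
    (fun i hi => (hlev i hi).symm.le) hws ?_ hu
  · exact h
  · intro i hi
    have : ∑ l ∈ range m, G i l * (s * a l) = s * ∑ l ∈ range m, G i l * a l := by
      rw [mul_sum]; exact sum_congr rfl fun _ _ => by ring
    rw [this, hlev i hi]; ring

/-! ## §2 The subsolution certificate at a young step of the level-coupled system -/

/-- Splitting a sum over `range (n+1)` whose summand is defined by cases on `l < n`. [folklore] -/
theorem sum_range_succ_ite {n : ℕ} (f g : ℕ → ℝ) :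
    ∑ l ∈ range (n + 1), (if l < n then f l else g l) = ∑ l ∈ range n, f l + g n := by
  rw [sum_range_succ, if_neg (lt_irrefl n)]
  congr 1
  exact sum_congr rfl fun l hl => if_pos (mem_range.mp hl)

variable {n : ℕ} {X S : ℕ → ℝ} {Sr : ℕ → ℕ → ℝ} {σ a' : ℕ → ℝ} {xz s M az' : ℝ}

/-- **A SUBSOLUTION PAIR CAPS THE YOUNG LOAD.**  Letters of the level-coupled system at a young scale `z` (README §2): older ages `l < n` with
loads `X_l = 2x_l ≥ 0`; `Sr l i = S(k_l,k_i)∕k_l ≥ 0` the coefficient of the level `a_l` in the row of the older age `i`; the young's reads on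
the old row `i`, `φ_i = S(z,k_i)∕z ≥ 0`; the old charge on the young's row, `σ_l = S(k_l,z)∕k_l ≥ 0`; `s = S(z,z)∕z ≥ 0`; young load `xz ≥ 0`
(entering its column as `2·xz`).  If the full system (old ages + the young with load `xz`) has positive levels `a', az'` (`hrow`, `hrowz`), and
at some trial load `xs` there is a NON-NEGATIVE SUBSOLUTION PAIR `(c, t)` with `t > 0` — old rows `c_i ≤ Σ_l X_l Sr_{li} c_l + 2·xs·φ_i·t`, young
row `t ≤ Σ_l X_l σ_l c_l + 2·xs·s·t` — then `xz < xs`: the pair would remain a subsolution at every load `≥ xs`, and `eq_zero_of_subsolution`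
forbids it. [folklore] -/
theorem load_lt_of_subsolution {t xs : ℝ}
    (hX : ∀ l, l < n → 0 ≤ X l) (hSr : ∀ l i, l < n → i < n → 0 ≤ Sr l i) (hφ : ∀ i, i < n → 0 ≤ φ i)
    (hσ : ∀ l, l < n → 0 ≤ σ l) (hs : 0 ≤ s) (hxz : 0 ≤ xz)
    (ha' : ∀ i, i < n → 0 < a' i) (haz' : 0 < az')
    (hrow : ∀ i, i < n → 1 + ∑ l ∈ range n, X l * Sr l i * a' l + 2 * xz * φ i * az' ≤ a' i)
    (hrowz : 1 + ∑ l ∈ range n, X l * σ l * a' l + 2 * xz * s * az' ≤ az')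
    (hc0 : ∀ i, i < n → 0 ≤ c i) (ht : 0 < t)
    (hold : ∀ i, i < n → c i ≤ ∑ l ∈ range n, X l * Sr l i * c l + 2 * xs * φ i * t)
    (hyoung : t ≤ ∑ l ∈ range n, X l * σ l * c l + 2 * xs * s * t) :
    xz < xs := by
  by_contra hcon
  have hcon : xs ≤ xz := not_lt.mp hcon
  -- the full system on `range (n+1)`, the young at index `n`
  let G' : ℕ → ℕ → ℝ := fun i l =>
    if l < n then (if i < n then X l * Sr l i else X l * σ l) else (if i < n then 2 * xz * φ i else 2 * xz * s)
  let a'' : ℕ → ℝ := fun i => if i < n then a' i else az'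
  let v : ℕ → ℝ := fun i => if i < n then c i else t
  have hGrow : ∀ (i : ℕ) (f : ℕ → ℝ), ∑ l ∈ range (n + 1), G' i l * f l =
      ∑ l ∈ range n, (if i < n then X l * Sr l i else X l * σ l) * f l + (if i < n then 2 * xz * φ i else 2 * xz * s) * f n := by
    intro i f
    have := sum_range_succ_ite (n := n) (fun l => (if i < n then X l * Sr l i else X l * σ l) * f l)
      (fun l => (if i < n then 2 * xz * φ i else 2 * xz * s) * f l)
    rw [← this]
    refine sum_congr rfl fun l _ => ?_
    by_cases hl : l < n <;> simp [G', hl]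
  have hzero := eq_zero_of_subsolution (m := n + 1) (G := G') (a := a'') (v := v) ?_ ?_ ?_ ?_ ?_
  · have h1 : v n = 0 := hzero n (Nat.lt_succ_self n)
    simp only [v, lt_irrefl, if_false] at h1
    linarith
  · intro i l hi hl
    by_cases hi' : i < n <;> by_cases hl' : l < n
    · simp only [G', hi', hl', if_true]; exact mul_nonneg (hX l hl') (hSr l i hl' hi')
    · simp only [G', hi', hl', if_true, if_false]; exact mul_nonneg (mul_nonneg (by norm_num) hxz) (hφ i hi')
    · simp only [G', hi', hl', if_true, if_false]; exact mul_nonneg (hX l hl') (hσ l hl')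
    · simp only [G', hi', hl', if_false]; exact mul_nonneg (mul_nonneg (by norm_num) hxz) hs
  · intro i hi
    by_cases hi' : i < n
    · simp only [a'', hi', if_true]; exact ha' i hi'
    · simp only [a'', hi', if_false]; exact haz'
  · intro i hi
    rw [hGrow]
    by_cases hi' : i < n
    · simp only [a'', hi', if_true, lt_irrefl, if_false]
      have : ∑ l ∈ range n, X l * Sr l i * (if l < n then a' l else az') = ∑ l ∈ range n, X l * Sr l i * a' l :=
        sum_congr rfl fun l hl => by rw [if_pos (mem_range.mp hl)]
      rw [this]; linarith [hrow i hi']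
    · have hin : i = n := by omega
      subst hin
      simp only [a'', lt_irrefl, if_false]
      have : ∑ l ∈ range i, X l * σ l * (if l < i then a' l else az') = ∑ l ∈ range i, X l * σ l * a' l :=
        sum_congr rfl fun l hl => by rw [if_pos (mem_range.mp hl)]
      rw [this]; linarith [hrowz]
  · intro i hi
    by_cases hi' : i < n
    · simp only [v, hi', if_true]; exact hc0 i hi'
    · simp only [v, hi', if_false]; exact ht.le
  · intro i hi
    rw [hGrow]
    by_cases hi' : i < n
    · simp only [v, hi', if_true, lt_irrefl, if_false]
      have : ∑ l ∈ range n, X l * Sr l i * (if l < n then c l else t) = ∑ l ∈ range n, X l * Sr l i * c l :=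
        sum_congr rfl fun l hl => by rw [if_pos (mem_range.mp hl)]
      rw [this]
      have h2 : 2 * xs * φ i * t ≤ 2 * xz * φ i * t := by
        have := hφ i hi'; have := ht.le; gcongr
      linarith [hold i hi']
    · have hin : i = n := by omega
      subst hin
      simp only [v, lt_irrefl, if_false]
      have : ∑ l ∈ range i, X l * σ l * (if l < i then c l else t) = ∑ l ∈ range i, X l * σ l * c l :=
        sum_congr rfl fun l hl => by rw [if_pos (mem_range.mp hl)]
      rw [this]
      have h2 : 2 * xs * s * t ≤ 2 * xz * s * t := by
        have := ht.le; gcongr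
      linarith [hyoung]

/-- **THE SUBSOLUTION CERTIFICATE — exact form.**  In the letters of `load_lt_of_subsolution`: if `c ≥ 0` is the EXACT RESPONSE of the old system to
the young's reads, `c_i = φ_i + Σ_l X_l Sr_{li} c_l` (`nonneg_of_response`), `Ψ := Σ_l X_l σ_l c_l` is the RETURN AMPLIFICATION (the young's reads
raise the older levels, which charge back on the young's row), and a number `M > 0` satisfies THE CERTIFICATE INEQUALITY **`M ≤ 2(s + Ψ)`**, then
**`xz·M < 1`** for every load `xz` at which the full system has positive levels: the pair `(c, M∕2)` is a subsolution at the trial load `1∕M`.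
With `M = M_z := (1+V_z)∕(1−Ω_z)` the window-mass chain's multiplier this is STATIC CLOSURE at the young step `z` (`ρ_z = x_z·M_z < 1`), and
`1∕(2(s_z+Ψ_zz))` is exactly the young's cap `x̂_z` (README §2: `M_z·x̂_z ≤ 1`). [folklore] -/
theorem load_mul_lt_one_of_certificate
    (hX : ∀ l, l < n → 0 ≤ X l) (hSr : ∀ l i, l < n → i < n → 0 ≤ Sr l i) (hφ : ∀ i, i < n → 0 ≤ φ i)
    (hσ : ∀ l, l < n → 0 ≤ σ l) (hs : 0 ≤ s) (hxz : 0 ≤ xz)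
    (ha' : ∀ i, i < n → 0 < a' i) (haz' : 0 < az')
    (hrow : ∀ i, i < n → 1 + ∑ l ∈ range n, X l * Sr l i * a' l + 2 * xz * φ i * az' ≤ a' i)
    (hrowz : 1 + ∑ l ∈ range n, X l * σ l * a' l + 2 * xz * s * az' ≤ az')
    (hc : ∀ i, i < n → c i = φ i + ∑ l ∈ range n, X l * Sr l i * c l) (hc0 : ∀ i, i < n → 0 ≤ c i)
    (hM : 0 < M) (hcert : M ≤ 2 * (s + ∑ l ∈ range n, X l * σ l * c l)) :
    xz * M < 1 := by
  have h := load_lt_of_subsolution (t := M / 2) (xs := 1 / M) hX hSr hφ hσ hs hxz ha' haz' hrow hrowz hc0 (by positivity) ?_ ?_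
  · calc xz * M < 1 / M * M := mul_lt_mul_of_pos_right h hM
      _ = 1 := by field_simp
  · intro i hi
    have : 2 * (1 / M) * φ i * (M / 2) = φ i := by field_simp
    rw [this, hc i hi]; linarith
  · have : 2 * (1 / M) * s * (M / 2) = s := by field_simp
    rw [this]; linarith

/-- **THE SUBSOLUTION CERTIFICATE — level form.**  Same letters; now `a > 0` are the EXACT LEVELS of the old system alone, `a_i = 1 + Σ_l X_l Sr_{li} a_l`,
`A := 1 + Σ_l X_l σ_l a_l` is the level an UNLOADED scale `z` would have under the old system, the young's reads dominate its self-read, `φ_i ≥ s`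
(`S(z,k) ≥ S(z,z)` for `k ≥ z`), and `M > 0` satisfies **`M ≤ 2·s·A`**.  Then **`xz·M < 1`** at every load with positive full levels: at the trial load
`1∕M`, either `2s∕M ≥ 1` and `(0, 1)` is a subsolution pair, or `(a, (A−1)∕(1 − 2s∕M))` is one.  (Weaker than the exact form — `Ψ ≥ s(A − 1)` by
`response_ge_mul_level` — but it needs no response vector; README §3: numerically `sup M_z∕(2s_zA_z) = 0.728`, at `z = 1`.) [folklore] -/
theorem load_mul_lt_one_of_level_certificate
    (hX : ∀ l, l < n → 0 ≤ X l) (hSr : ∀ l i, l < n → i < n → 0 ≤ Sr l i) (hφs : ∀ i, i < n → s ≤ φ i)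
    (hσ : ∀ l, l < n → 0 ≤ σ l) (hs : 0 ≤ s) (hxz : 0 ≤ xz)
    (ha' : ∀ i, i < n → 0 < a' i) (haz' : 0 < az')
    (hrow : ∀ i, i < n → 1 + ∑ l ∈ range n, X l * Sr l i * a' l + 2 * xz * φ i * az' ≤ a' i)
    (hrowz : 1 + ∑ l ∈ range n, X l * σ l * a' l + 2 * xz * s * az' ≤ az')
    (ha : ∀ i, i < n → a i = 1 + ∑ l ∈ range n, X l * Sr l i * a l) (ha0 : ∀ i, i < n → 0 < a i)
    (hM : 0 < M) (hcert : M ≤ 2 * s * (1 + ∑ l ∈ range n, X l * σ l * a l)) :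
    xz * M < 1 := by
  have hφ : ∀ i, i < n → 0 ≤ φ i := fun i hi => hs.trans (hφs i hi)
  set B := ∑ l ∈ range n, X l * σ l * a l with hB
  have hB0 : 0 ≤ B := sum_nonneg fun l hl =>
    mul_nonneg (mul_nonneg (hX l (mem_range.mp hl)) (hσ l (mem_range.mp hl))) (ha0 l (mem_range.mp hl)).le
  suffices h : xz < 1 / M by
    calc xz * M < 1 / M * M := mul_lt_mul_of_pos_right h hM
      _ = 1 := by field_simp
  by_cases hcase : 1 ≤ 2 * (1 / M) * s
  · -- the trivial pair `(0, 1)`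
    refine load_lt_of_subsolution (c := fun _ => 0) (t := 1) (xs := 1 / M) hX hSr hφ hσ hs hxz ha' haz' hrow hrowz
      (fun _ _ => le_rfl) one_pos ?_ ?_
    · intro i hi
      have h0 : ∑ l ∈ range n, X l * Sr l i * (fun _ => (0:ℝ)) l = 0 := sum_eq_zero fun _ _ => by simp
      rw [h0]; have := hφ i hi; positivity
    · have h0 : ∑ l ∈ range n, X l * σ l * (fun _ => (0:ℝ)) l = 0 := sum_eq_zero fun _ _ => by simp
      rw [h0]; linarith
  · -- the pair `(a, B ∕ (1 − 2s∕M))`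
    have hden : 0 < 1 - 2 * (1 / M) * s := by linarith [not_le.mp hcase]
    have hkey : 1 ≤ 2 * (1 / M) * s * (1 + B) := by
      rw [show 2 * (1 / M) * s * (1 + B) = (2 * s * (1 + B)) / M by ring, le_div_iff₀ hM]; linarith
    have hBpos : 0 < B := by
      by_contra hB'
      have hB1 : B = 0 := le_antisymm (not_lt.mp hB') hB0
      rw [hB1] at hkey; linarith [not_le.mp hcase]
    have ht : 0 < B / (1 - 2 * (1 / M) * s) := div_pos hBpos hden
    refine load_lt_of_subsolution (c := a) (t := B / (1 - 2 * (1 / M) * s)) (xs := 1 / M) hX hSr hφ hσ hs hxz ha' haz' hrow hrowz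
      (fun i hi => (ha0 i hi).le) ht ?_ ?_
    · intro i hi
      -- `a_i = (a_i − 1) + 1` and `1 ≤ 2·(1∕M)·s·t ≤ 2·(1∕M)·φ_i·t`
      have h1 : 1 ≤ 2 * (1 / M) * s * (B / (1 - 2 * (1 / M) * s)) := by
        rw [show 2 * (1 / M) * s * (B / (1 - 2 * (1 / M) * s)) = (2 * (1 / M) * s * B) / (1 - 2 * (1 / M) * s) by ring,
          le_div_iff₀ hden]
        nlinarith
      have h2 : 2 * (1 / M) * s * (B / (1 - 2 * (1 / M) * s)) ≤ 2 * (1 / M) * φ i * (B / (1 - 2 * (1 / M) * s)) := by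
        have := hφs i hi; have := ht.le; gcongr
      linarith [ha i hi]
    · rw [← hB]
      have htd : B / (1 - 2 * (1 / M) * s) * (1 - 2 * (1 / M) * s) = B := div_mul_cancel₀ B hden.ne'
      have h3 : 2 * (1 / M) * s * (B / (1 - 2 * (1 / M) * s)) =
          B / (1 - 2 * (1 / M) * s) - B / (1 - 2 * (1 / M) * s) * (1 - 2 * (1 / M) * s) := by ring
      rw [htd] at h3
      rw [h3]; linarith

/-! ## §3 Algebra of the observer hypothesis (README §4): the chain side of the induction over the ages -/

/-- **THE OBSERVER BOUND IMPLIES THE CERTIFICATE INEQUALITY.**  If the chain's numerator at an observer scale obeys `N ≤ (1 + 2κΨ)(1 − Ω)` with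
`0 ≤ Ω < 1`, `0 ≤ Ψ`, `κ ≤ 1` and `s ≥ 1∕2` (every `s_z = S(z,z)∕z ≥ 1∕√2`), then the multiplier `M = N∕(1−Ω)` satisfies `M ≤ 1 + 2κΨ ≤ 2(s + Ψ)` —
the hypothesis of `load_mul_lt_one_of_certificate`. [folklore] -/
theorem multiplier_le_of_observer_bound {N Ψ Ω κ : ℝ} (hΩ : Ω < 1) (hΨ : 0 ≤ Ψ) (hκ : κ ≤ 1) (hs : 1 / 2 ≤ s)
    (hN : N ≤ (1 + 2 * κ * Ψ) * (1 - Ω)) : N / (1 - Ω) ≤ 2 * (s + Ψ) := by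
  rw [div_le_iff₀ (by linarith)]
  have h1 : 1 + 2 * κ * Ψ ≤ 2 * (s + Ψ) := by nlinarith [mul_le_mul_of_nonneg_right hκ hΨ]
  have h2 : (1 + 2 * κ * Ψ) * (1 - Ω) ≤ 2 * (s + Ψ) * (1 - Ω) := mul_le_mul_of_nonneg_right h1 (by linarith)
  linarith

/-- **THE RATIO BOUND OF A PROCESSED AGE.**  From the observer bound at the age's own scale, `N_y ≤ (1+2κΨ_yy)(1−Ω_y)`, its chain ratio
`ρ_y = x_y·N_y∕(1−Ω_y)` is at most `ρ̄_y := x_y(1 + 2κΨ_yy)`; and `ρ̄_y ≤ 1 − D_y < 1` where `D_y = 1 − 2x_y(s_y + Ψ_yy) > 0` is the Schur pivot of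
the age's row (`κ ≤ 1`, `s_y ≥ 1∕2`): THE CHAIN'S COMPOUNDING `1∕(1−ρ_y)` IS AT MOST THE RESOLVENT'S `1∕D_y`. [folklore] -/
theorem ratio_le_ratio_bar {x N Ψ Ω κ : ℝ} (hx : 0 ≤ x) (hΩ : Ω < 1) (hN : N ≤ (1 + 2 * κ * Ψ) * (1 - Ω)) :
    x * N / (1 - Ω) ≤ x * (1 + 2 * κ * Ψ) := by
  rw [div_le_iff₀ (by linarith)]
  have := mul_le_mul_of_nonneg_left hN hx
  nlinarith

/-- `ρ̄ = x(1+2κΨ) ≤ 2x(s+Ψ) = 1 − D` for `κ ≤ 1`, `s ≥ 1∕2`, `x, Ψ ≥ 0`. [folklore] -/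
theorem ratio_bar_le_one_sub_pivot {x Ψ κ : ℝ} (hx : 0 ≤ x) (hΨ : 0 ≤ Ψ) (hκ : κ ≤ 1) (hs : 1 / 2 ≤ s) :
    x * (1 + 2 * κ * Ψ) ≤ 2 * x * (s + Ψ) := by nlinarith [mul_nonneg hx hΨ]

/-- **MONOTONICITY OF THE NUMERATOR UPDATE.**  Adding a young age `y` with ratio `ρ` multiplies the chain and contributes its own defect:
`N' = (N − (1−θ)ρ)∕(1−ρ)` ((E72a) `one_add_load_succ_mul`, `θ = θ̄(y∕z) ∈ [0,1]` the defect of `y` seen from the observer `z`).  This is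
non-decreasing in `N` and — because `N ≥ 1 ≥ 1 − θ` — in `ρ ∈ [0,1)`; so bounds `N ≤ N̄`, `ρ ≤ ρ̄ < 1` give `N' ≤ (N̄ − (1−θ)ρ̄)∕(1−ρ̄)`. [folklore] -/
theorem succ_numerator_le {N N' Nb ρ ρb θ : ℝ} (hθ0 : 0 ≤ θ) (hN1 : 1 ≤ N) (hNN : N ≤ Nb)
    (hρρ : ρ ≤ ρb) (hρb : ρb < 1) (hN' : N' * (1 - ρ) = N - (1 - θ) * ρ) :
    N' ≤ (Nb - (1 - θ) * ρb) / (1 - ρb) := by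
  rw [le_div_iff₀ (by linarith)]
  have h1 : N' = (N - (1 - θ) * ρ) / (1 - ρ) := by rw [eq_div_iff (by linarith)]; exact hN'
  rw [h1, div_mul_eq_mul_div, div_le_iff₀ (by linarith)]
  nlinarith [mul_nonneg (sub_nonneg.mpr hρρ) (by linarith : 0 ≤ Nb - 1 + θ), mul_nonneg (sub_nonneg.mpr hNN) (by linarith : 0 ≤ 1 - ρ)]

/-- **THE OBSERVER STEP, MODULO THE RESOLVENT INEQUALITY.**  The induction over the ages (README §4) carries, for every scale `z` below the processed
set, the OBSERVER BOUND `N_z ≤ N̄_z := (1 + 2κΨ_zz)(1 − Ω_z)`.  When the next age `y` (`z < y <` processed) is added: `ρ_y ≤ ρ̄_y = x_y(1+2κΨ_yy) < 1`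
(`ratio_le_ratio_bar`, `ratio_bar_le_one_sub_pivot`), `N_z' ≤ (N̄_z − (1−θ)ρ̄_y)∕(1−ρ̄_y)` (`succ_numerator_le`), and the new target is
`N̄_z' = (1 + 2κΨ_zz')(1 − Ω_z')` with `Ψ_zz' = Ψ_zz + (2x_y∕D_y)(σ_y(z) + Ψ_yz)(φ_y(z) + Ψ_zy)` (rank-one update of the resolvent) and `Ω_z' = Ω_z +
x_y z∕y`.  So the bound PROPAGATES as soon as the pure resolvent inequality (◆) `N̄_z − (1−θ)ρ̄_y ≤ (1 − ρ̄_y)·N̄_z'` holds — a statement about the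
level-coupled system alone, with no chain quantity in it (README §4–§5: numerically `sup LHS∕RHS = 0.92` at `κ = 0.775`). [folklore] -/
theorem observer_step {N N' Nb Nb' ρ ρb θ : ℝ} (hθ0 : 0 ≤ θ) (hN1 : 1 ≤ N) (hNN : N ≤ Nb)
    (hρρ : ρ ≤ ρb) (hρb : ρb < 1) (hN' : N' * (1 - ρ) = N - (1 - θ) * ρ)
    (hdia : Nb - (1 - θ) * ρb ≤ (1 - ρb) * Nb') : N' ≤ Nb' := by
  have h := succ_numerator_le hθ0 hN1 hNN hρρ hρb hN'
  refine h.trans ?_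
  rw [div_le_iff₀ (by linarith)]
  linarith

end Summit.QuantumFields.BalabanUV.Beta.EriceRemainderEnclosureHistoryAutonomyComparisonAgeCompositionStaticChainCertificate

end
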